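import Literature.AnabelianGeometry.EtaleTheta.Discharge.Sec4Thm44OfConnectedTemperoid
import HarnessLib

/-!
# [EtTh] Thm 4.4 (i): the pin `Ψ^bs ≅ B^temp(θ⁻¹)` TOGETHER WITH `θ(H_{⊙,1}) = H_{⊙,2}` over `B^temp(Π^tp_X)⁰`

S. Mochizuki, *The étale theta function …*, Publ. RIMS 45 (2009) [MochizukiEtTh2009], Thm 4.4 (i) p.320 (PDF p.94)
«`Ψ^bs` induces an isomorphism `H_{⊙,1} ⥲ H_{⊙,2}`, well-defined up to composition with inner automorphisms of
`Π^tp_{X_i}`», proof p.321 ll.5–6 «[SemiAnbd], Proposition 3.2; Theorem A.4»; S. Mochizuki, *Semi-graphs of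
anabelioids* [MochizukiSemiAnbd2006], Prop 3.2 p.35.

abc-iut-w5-d013's `Thm44Hyp.hodotCompatible_ofConnectedPart` exports T44-L09 as `∃ θ, θ(H_{⊙,1}) = H_{⊙,2}` and forgets
that `θ` is THE isomorphism `Ψ^bs` arises from.  The [FrdII] Def 2.2 context isomorphism of Thm 4.4 (iii) (T44-L15b at
the faithful reading, abc-iut-w6-d047's `BiKummerThm44SubNHSatDef22*.lean`) needs both at once — the SAME `θ` must
descend to `G_{K₁} ⥲ G_{K₂}` (fields `isoG`, `map_H`) AND pin `Ψ^bs` (fields `isoE`, `outer_isoG`).  This file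
re-exports the pin with the tie kept (proof-only; the proof is w5-d013's, the statement is the conjunction):

* `Thm44Hyp.exists_pin_ofConnectedPart` — ∃ `θ : Π^tp_{X₁} ≃ₜ* Π^tp_{X₂}` with `θ(H_{⊙,1}) = H_{⊙,2}` ∧
  `Ψ^bs ⋙ ι ≅ ι ⋙ B^temp(θ⁻¹)` (`ι` the inclusions of the connected parts);
* `Thm44Hyp.exists_pin_mkOfConnectedTemperoid` — the literal instance for `mkOfConnectedTemperoid`.
-/

noncomputable section

namespace Literature.AnabelianGeometry.EtaleTheta

open CategoryTheory Opposite Literature.AlgebraicGeometry.Frobenioids Literature.AnabelianGeometry.SemiGraphs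
  Literature.AnabelianGeometry.SemiGraphs.GaloisObjects

namespace BiKummerSetting

universe u₀ v₀ w

variable {K : Type u₀} [Field K] {K' : Type u₀} [Field K'] {X₁ : SemiGraphs.TemperedArithmeticGroup.{u₀} K}
  {X₂ : SemiGraphs.TemperedArithmeticGroup.{u₀} K'} {D₀ : Type u₀} [Category.{v₀} D₀] {D₀' : Type u₀}
  [Category.{v₀} D₀'] {V : FrdIMonoidStub.{w}} {T₁ : RealifiedDivisorMonoids (D₀ := D₀) V}
  {T₂ : RealifiedDivisorMonoids (D₀ := D₀') V}
  {VD₁ : FrdICatStub.{u₀ + 1, u₀, w} (ConnectedPart (BTemp X₁.Pi))}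
  {VD₂ : FrdICatStub.{u₀ + 1, u₀, w} (ConnectedPart (BTemp X₂.Pi))}

section OfConnectedPart

variable {S₁ : BiKummerSetting X₁ T₁ (ConnectedPart (BTemp X₁.Pi)) VD₁}
  {S₂ : BiKummerSetting X₂ T₂ (ConnectedPart (BTemp X₂.Pi)) VD₂}

/-- **T44-L09 WITH THE PIN KEPT** over `B^temp(Π^tp_X)⁰`: for settings over the connected parts whose Galois data are
the temperoid's and any `h : Thm44Hyp S₁ S₂`, there is an isomorphism of topological groups
`θ : Π^tp_{X₁} ⥲ Π^tp_{X₂}` with BOTH `θ(H_{⊙,1}) = H_{⊙,2}` AND `Ψ^bs ⋙ ι ≅ ι ⋙ B^temp(θ⁻¹)` — the extension of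
`Ψ^bs` to the temperoids (`BTemp.exists_equivalence_extension`) pinned by [SemiAnbd] Prop 3.2
(`BTemp.exists_res_iso_of_equivalence`), and `H_{⊙,2} = θ⁻¹⁻¹… = θ(H_{⊙,1})` for THAT pin
(`Thm44Hyp.hodot_eq_comap_ofEmbedded`). [cite: MochizukiEtTh2009, Thm 4.4 (i) p.320 (PDF p.94)] -/
theorem Thm44Hyp.exists_pin_ofConnectedPart (h : Thm44Hyp S₁ S₂)
    (hg₁ : ∀ (A : ConnectedPart (BTemp X₁.Pi)) (hA : S₁.IsGaloisObj A), ∃ hA' : SemiGraphs.IsGaloisObj A.obj,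
      ∀ g : X₁.Pi, (S₁.galoisSurj A hA g).hom.hom = (galoisSurjOf X₁.isTempered A.obj hA' g).hom)
    (hg₂ : ∀ (B : ConnectedPart (BTemp X₂.Pi)) (hB : S₂.IsGaloisObj B), ∃ hB' : SemiGraphs.IsGaloisObj B.obj,
      ∀ g : X₂.Pi, (S₂.galoisSurj B hB g).hom.hom = (galoisSurjOf X₂.isTempered B.obj hB' g).hom) :
    ∃ θ : X₁.Pi ≃ₜ* X₂.Pi, S₁.Hodot.map θ.toMulEquiv.toMonoidHom = S₂.Hodot ∧
      Nonempty (h.Ψbs.functor ⋙ (connectedObjects (BTemp X₂.Pi)).ι ≅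
        (connectedObjects (BTemp X₁.Pi)).ι ⋙ BTemp.res (θ.symm : X₂.Pi →ₜ* X₁.Pi)) := by
  haveI := X₁.secondCountableTopology
  haveI := X₂.secondCountableTopology
  obtain ⟨E, ⟨ηE⟩⟩ := BTemp.exists_equivalence_extension h.Ψbs
  obtain ⟨φ, ψ, hψφ, hφψ, ⟨iφ⟩, -⟩ := BTemp.exists_res_iso_of_equivalence X₁.isTempered X₂.isTempered E
  let η : h.Ψbs.functor ⋙ (connectedObjects (BTemp X₂.Pi)).ι ≅ (connectedObjects (BTemp X₁.Pi)).ι ⋙ BTemp.res φ :=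
    ηE ≪≫ Functor.isoWhiskerLeft _ iφ
  let θ : X₁.Pi ≃ₜ* X₂.Pi :=
    { toFun := ψ, invFun := φ, left_inv := hφψ, right_inv := hψφ, map_mul' := fun x y => map_mul ψ x y
      continuous_toFun := ψ.continuous, continuous_invFun := φ.continuous }
  have hθ : θ.toMulEquiv.symm.toMonoidHom = φ.toMonoidHom := MonoidHom.ext fun _ => rfl
  have hθ' : (θ.symm : X₂.Pi →ₜ* X₁.Pi) = φ := ContinuousMonoidHom.ext fun _ => rfl
  refine ⟨θ, ?_, ⟨?_⟩⟩
  · rw [Subgroup.map_equiv_eq_comap_symm', hθ]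
    exact (h.hodot_eq_comap_ofEmbedded (connectedObjects (BTemp X₁.Pi)).ι (connectedObjects (BTemp X₂.Pi)).ι
      hg₁ hg₂ φ (fun x => ⟨ψ x, hφψ x⟩) η).symm
  · rw [hθ']
    exact η

end OfConnectedPart

/-! ### The literal instance for abc-iut-L2-t4's `BiKummerSetting.mkOfConnectedTemperoid` -/

section MkOfConnectedTemperoid

variable (tf₁ : TemperedFrobenioid T₁ (ConnectedPart (BTemp X₁.Pi)) VD₁) (hZ₁ : tf₁.monoidType = MonoidType.Z)
  (hP₁ : ∀ A : (ConnectedPart (BTemp X₁.Pi))ᵒᵖ, IsPerfect (tf₁.Φ.carrier A))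
  (NH₁ : Subgroup (Field.absoluteGaloisGroup K) → tf₁.category → ℕ+ → Prop) (A₁ : tf₁.category)
  (hA₁ : PreFrobenioid.IsFrobeniusTrivial tf₁.toElem A₁) (hA₁' : SemiGraphs.IsGaloisObj A₁.base.obj)
  (tf₂ : TemperedFrobenioid T₂ (ConnectedPart (BTemp X₂.Pi)) VD₂) (hZ₂ : tf₂.monoidType = MonoidType.Z)
  (hP₂ : ∀ B : (ConnectedPart (BTemp X₂.Pi))ᵒᵖ, IsPerfect (tf₂.Φ.carrier B))
  (NH₂ : Subgroup (Field.absoluteGaloisGroup K') → tf₂.category → ℕ+ → Prop) (A₂ : tf₂.category)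
  (hA₂ : PreFrobenioid.IsFrobeniusTrivial tf₂.toElem A₂) (hA₂' : SemiGraphs.IsGaloisObj A₂.base.obj)

/-- **T44-L09 WITH THE PIN KEPT for the settings `mkOfConnectedTemperoid` — UNCONDITIONAL**: `∃ θ`, `θ(H_{⊙,1}) = H_{⊙,2}`
∧ `Ψ^bs ⋙ ι ≅ ι ⋙ B^temp(θ⁻¹)`. [cite: MochizukiEtTh2009, Thm 4.4 (i) p.320 (PDF p.94)] -/
theorem Thm44Hyp.exists_pin_mkOfConnectedTemperoid
    (h : Thm44Hyp (mkOfConnectedTemperoid X₁ tf₁ hZ₁ hP₁ NH₁ A₁ hA₁ hA₁')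
      (mkOfConnectedTemperoid X₂ tf₂ hZ₂ hP₂ NH₂ A₂ hA₂ hA₂')) :
    ∃ θ : X₁.Pi ≃ₜ* X₂.Pi,
      (mkOfConnectedTemperoid X₁ tf₁ hZ₁ hP₁ NH₁ A₁ hA₁ hA₁').Hodot.map θ.toMulEquiv.toMonoidHom =
          (mkOfConnectedTemperoid X₂ tf₂ hZ₂ hP₂ NH₂ A₂ hA₂ hA₂').Hodot ∧
        Nonempty (h.Ψbs.functor ⋙ (connectedObjects (BTemp X₂.Pi)).ι ≅
          (connectedObjects (BTemp X₁.Pi)).ι ⋙ BTemp.res (θ.symm : X₂.Pi →ₜ* X₁.Pi)) :=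
  h.exists_pin_ofConnectedPart (fun _ hA => ⟨hA, fun _ => rfl⟩) (fun _ hB => ⟨hB, fun _ => rfl⟩)

end MkOfConnectedTemperoid

end BiKummerSetting

end Literature.AnabelianGeometry.EtaleTheta

end
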